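import Literature.AlgebraicGeometry.AbelianSchemes.AbelianSchemeDualIsogeny
import Literature.AlgebraicGeometry.AbelianSchemes.AbelianSchemeQuotientPoincareSlices
import HarnessLib

/-!
# Functoriality of the dual homomorphism: `(ψ ≫ χ)^∨ = χ^∨ ≫ ψ^∨` (HECKE-LINK, input of the H2c identity)

Layer `Literature/AlgebraicGeometry/AbelianSchemes`, namespace `Literature.AlgebraicGeometry.AbelianSchemes.AbelianSchemeOver.DualPair`.
Cell `hodgecm-mathlib`, HECKE-LINK line card v1.2, over ★ `AbelianSchemeDualIsogeny` (p745813: `dualIsogeny ψ D′ DB = ψ^∨` classifies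
`(ψ × 1)^*𝒫_B`, `eq_dualIsogeny`) and ★ `AbelianSchemeQuotientPoincareSlices` (p746968: `baseChangeHom_left_eq_whiskerRight_left`).
[MumfordAV1970] §15 Thm. 1 (p. 143); [MilneAV2008] I §9: for homomorphisms `ψ : A′ → B`, `χ : B → C` of abelian schemes over `S`
with dual pairs `D′, DB, DC`, **`dualIsogeny (ψ ≫ χ) D′ DC = dualIsogeny χ DB DC ≫ dualIsogeny ψ D′ DB`** — both sides classify
`((ψ ≫ χ) × 1)^*𝒫_C` on `A′` parametrised by `Ĉ`; the right-hand side because `(1 × χ^∨ψ^∨)^*𝒫′ = (1 × χ^∨)^*(1 × ψ^∨)^*𝒫′ ≅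
(1 × χ^∨)^*(ψ × 1)^*𝒫_B = (ψ × 1)^*(1 × χ^∨)^*𝒫_B ≅ (ψ × 1)^*(χ × 1)^*𝒫_C` (whisker exchange in `Over S`; every carrier is
`(X ⊗ Y).left`, so no base transport is needed).  The H2c identity reads `ψ ≫ λ_B ≫ ψ^∨ = λ ≫ ψ̂ ≫ ψ^∨ = λ ≫ π^∨ ≫ ψ^∨ =
λ ≫ (ψ ≫ π)^∨ = λ ≫ [n]^∨` (★ `quotientMk_comp_polarizationDesc`, ★ `quotientMk_left_eq_dualIsogeny_mulNDesc`, this file).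
THEOREMS ONLY; no definition, no instance, no sorry.  HC_CM is proved only modulo the 7 printed citations until rung 0 closes.

## References
* [MumfordAV1970] D. Mumford, *Abelian Varieties* (1970), §15 Thm. 1 (p. 143).
* [MilneAV2008] J. S. Milne, *Abelian Varieties* (2008), I §8 pp. 36–37, I §9 (p. 42).
-/

noncomputable section

universe u

open CategoryTheory CategoryTheory.Limits AlgebraicGeometry MonoidalCategory CartesianMonoidalCategory
open scoped MonObj

namespace Literature.AlgebraicGeometry.AbelianSchemes

namespace AbelianSchemeOver

namespace DualPair

variable {S : Scheme.{u}} {A' B C : AbelianSchemeOver S} (ψ : A'.X ⟶ B.X) (χ : B.X ⟶ C.X) [IsMonHom ψ] [IsMonHom χ]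
  (D' : A'.DualPair) (DB : B.DualPair) (DC : C.DualPair)

/-- `1_B × g = B ◁ g` on underlying maps, for an `S`-morphism `g : T′ → B̂` between the duals (`g` given in `Over S`).
[cite: MilneAV2008, I §8 pp. 36–37] -/
theorem baseChangeToProd_eq_whiskerLeft_left {T' : Over S} (g : T' ⟶ DB.hat.X) :
    B.baseChangeToProd DB.hat T'.hom g.left (Over.w g) = (B.X ◁ g).left := by
  apply pullback.hom_ext
  · exact (B.baseChangeToProd_fst DB.hat T'.hom _ _).trans (Over.whiskerLeft_left_fst (R := B.X) g).symm
  · exact (B.baseChangeToProd_snd DB.hat T'.hom _ _).trans (Over.whiskerLeft_left_snd (R := B.X) g).symm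

omit [IsMonHom ψ] in
/-- **`(1 × χ^∨)^*((ψ × 1)^*𝒫_B) ≅ ((ψ ≫ χ) × 1)^*𝒫_C`** on `A′ ×_S Ĉ`: the pull-back of the defining isomorphism of `χ^∨`
along `ψ × 1`, rearranged by the whisker exchange `(A′ ◁ χ^∨) ≫ (ψ ▷ B̂) = (ψ ▷ Ĉ) ≫ (B ◁ χ^∨)`.
[cite: MumfordAV1970, §15 Thm. 1 (p. 143)] [cite: MilneAV2008, I §8 pp. 36–37] -/
theorem nonempty_pullback_whiskerLeft_dualIsogeny_comapHom_iso :
    Nonempty ((Scheme.Modules.pullback (A'.X ◁ dualIsogenyOver χ DB DC).left).obj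
        ((Scheme.Modules.pullback (baseChangeHom ψ DB.hat.X.hom).left).obj DB.P) ≅
      (Scheme.Modules.pullback (baseChangeHom (ψ ≫ χ) DC.hat.X.hom).left).obj DC.P) := by
  obtain ⟨eχ⟩ := nonempty_pullbackP_dualIsogeny_iso χ DB DC
  -- `(ψ × 1_{B̂}) = ψ ▷ B̂`, `(χ × 1_{Ĉ}) = χ ▷ Ĉ`, `((ψ ≫ χ) × 1_{Ĉ}) = (ψ ≫ χ) ▷ Ĉ` on underlying maps
  have hψ := B.baseChangeHom_left_eq_whiskerRight_left DB A' ψ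
  have hχ := C.baseChangeHom_left_eq_whiskerRight_left DC B χ
  have hψχ := C.baseChangeHom_left_eq_whiskerRight_left DC A' (ψ ≫ χ)
  -- `1_B × χ^∨ = B ◁ χ^∨`
  have hg := baseChangeToProd_eq_whiskerLeft_left (B := B) DB (dualIsogenyOver χ DB DC)
  -- the whisker exchange, on underlying maps
  have hex : (A'.X ◁ dualIsogenyOver χ DB DC).left ≫ (ψ ▷ DB.hat.X).left =
      (ψ ▷ DC.hat.X).left ≫ (B.X ◁ dualIsogenyOver χ DB DC).left := by
    rw [← Over.comp_left, ← Over.comp_left, whisker_exchange]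
  -- `(ψ ▷ Ĉ) ≫ (χ ▷ Ĉ) = (ψ ≫ χ) ▷ Ĉ`
  have hcomp : (ψ ▷ DC.hat.X).left ≫ (χ ▷ DC.hat.X).left = ((ψ ≫ χ) ▷ DC.hat.X).left := by
    rw [← Over.comp_left, ← comp_whiskerRight]
  refine ⟨(Scheme.Modules.pullback _).mapIso ((Scheme.Modules.pullbackCongr hψ).app _) ≪≫
    (Scheme.Modules.pullbackComp _ _).app _ ≪≫ (Scheme.Modules.pullbackCongr hex).app _ ≪≫
    ((Scheme.Modules.pullbackComp _ _).app _).symm ≪≫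
    (Scheme.Modules.pullback _).mapIso (((Scheme.Modules.pullbackCongr hg).app _).symm ≪≫ eχ ≪≫
      (Scheme.Modules.pullbackCongr hχ).app _) ≪≫
    (Scheme.Modules.pullbackComp _ _).app _ ≪≫ (Scheme.Modules.pullbackCongr (hcomp.trans hψχ.symm)).app _⟩

/-- **Functoriality of the dual homomorphism: `(ψ ≫ χ)^∨ = χ^∨ ≫ ψ^∨`** (★ `eq_dualIsogeny`: `χ^∨ ≫ ψ^∨` classifies
`((ψ ≫ χ) × 1)^*𝒫_C`). [cite: MumfordAV1970, §15 Thm. 1 (p. 143)] [cite: MilneAV2008, I §9 Thm. 9.1 (p. 42)] -/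
theorem dualIsogeny_comp :
    dualIsogeny (ψ ≫ χ) D' DC = dualIsogeny χ DB DC ≫ dualIsogeny ψ D' DB := by
  symm
  refine eq_dualIsogeny (ψ ≫ χ) D' DC _ (by rw [Category.assoc, dualIsogeny_comp_hom, dualIsogeny_comp_hom]) ?_
  obtain ⟨eψ⟩ := nonempty_pullbackP_dualIsogeny_iso ψ D' DB
  obtain ⟨e⟩ := nonempty_pullback_whiskerLeft_dualIsogeny_comapHom_iso ψ χ DB DC
  -- `1_{A′} × (χ^∨ ≫ ψ^∨) = (A′ ◁ χ^∨) ≫ (1_{A′} × ψ^∨)` on underlying maps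
  have hfac : A'.baseChangeToProd D'.hat DC.hat.X.hom (dualIsogeny χ DB DC ≫ dualIsogeny ψ D' DB)
        (by rw [Category.assoc, dualIsogeny_comp_hom, dualIsogeny_comp_hom]) =
      (A'.X ◁ dualIsogenyOver χ DB DC).left ≫
        A'.baseChangeToProd D'.hat DB.hat.X.hom (dualIsogeny ψ D' DB) (dualIsogeny_comp_hom ψ D' DB) := by
    apply pullback.hom_ext
    · exact (A'.baseChangeToProd_fst D'.hat _ _ _).trans
        ((Category.assoc _ _ _).trans
          ((congrArg (fun t => (A'.X ◁ dualIsogenyOver χ DB DC).left ≫ t) (A'.baseChangeToProd_fst D'.hat _ _ _)).trans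
            (Over.whiskerLeft_left_fst (R := A'.X) (dualIsogenyOver χ DB DC)))).symm
    · exact (A'.baseChangeToProd_snd D'.hat _ _ _).trans
        ((Category.assoc _ _ _).trans
          ((congrArg (fun t => (A'.X ◁ dualIsogenyOver χ DB DC).left ≫ t) (A'.baseChangeToProd_snd D'.hat _ _ _)).trans
            ((Category.assoc _ _ _).symm.trans
              (congrArg (fun t => t ≫ dualIsogeny ψ D' DB)
                (Over.whiskerLeft_left_snd (R := A'.X) (dualIsogenyOver χ DB DC)))))).symm
  unfold pullbackP
  exact ⟨(Scheme.Modules.pullbackCongr hfac).app _ ≪≫ ((Scheme.Modules.pullbackComp _ _).app _).symm ≪≫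
    (Scheme.Modules.pullback _).mapIso eψ ≪≫ e⟩

/-- The same in `Over S`. [cite: MumfordAV1970, §15 Thm. 1 (p. 143)] -/
theorem dualIsogenyOver_comp :
    dualIsogenyOver (ψ ≫ χ) D' DC = dualIsogenyOver χ DB DC ≫ dualIsogenyOver ψ D' DB :=
  Over.OverMorphism.ext (by rw [dualIsogenyOver_left, Over.comp_left, dualIsogenyOver_left, dualIsogenyOver_left,
    dualIsogeny_comp ψ χ D' DB DC])

end DualPair

end AbelianSchemeOver

end Literature.AlgebraicGeometry.AbelianSchemes

end
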